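import Literature.AnabelianGeometry.SemiGraphs.TemperedCompactInVerticialCaseA
import HarnessLib

/-!
# [SemiAnbd] Theorem 3.7 (iii): the level data of a chart (rung-1 ↔ rung-3 interface)

Mochizuki, *Semi-graphs of anabelioids*, Publ. RIMS **42** (2006), §3, Theorem 3.7 (iii) and its
proof, manuscript pp. 40–41 [cite: MochizukiSemiAnbd2006, Thm 3.7(iii) pp.40-41], read together with
the author's *Comments* (May 2020), item (6) (cell file HOME/lit/SemiAnbd-Comments-2020.txt): the
proof lets `π₁^temp(𝒢) = lim_i Gal(𝒢_{∞,i}/𝒢)` act on the trees `𝒢_{∞,i}` (universal graph-coverings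
of the finite étale Galois coverings `𝒢_i`), and reads verticial / edge-like subgroups off compatible
systems of fixed vertices / fixed closed edges of these trees.

This file is the INTERFACE between the producer of that tower — rung 1 of the cell's ladder, the
construction of Proposition 3.6 (i)(ii) for a chart `c : TemperedPiChart 𝒢` (seat abc-iut-L3-t9) —
and its consumers: the first part of Theorem 3.7 (iii) (`compactInVerticial_conj1_caseA` /
`compactInVerticial_conj1_of_cases`, seat abc-iut-L3-t6, in the tree modulo level data) and the
second part (seat abc-iut-L3-t11's binders; assembled in the sequel).  No new mathematics:

* `ProfiniteSemiGraph.VerticialLevelData 𝒢 c` — ONE structure whose fields are exactly the union of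
  the binders of those consumers: a nonempty directed index preorder `J`; trees `tree j` (the
  `𝒢_{∞,j}`) with a vertex, over `𝒢.graph` (`proj`); actions `act j : c.G →* Aut (tree j)` over
  `𝒢.graph` with open kernels; functorial, equivariant transition morphisms
  `trans : i ≤ j → (tree j ⟶ tree i)`; and the three IDENTIFICATIONS (I1) `fix` (a verticial
  subgroup fixes a compatible system of tree vertices), (I2) `stab` (the pointwise stabiliser of a
  compatible vertex system lies in a verticial subgroup), (I3) `edge` (the stabiliser of an eventual
  compatible system of edges lies in an edge-like subgroup of the image edge).  PRODUCER CONTRACT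
  (rung 1): construct `VerticialLevelData 𝒢 c` from the Galois pro-system of `B^temp(𝒢)`.
* `VerticialLevelData.restrict` — the same data over a COFINAL subset of levels is again level data
  (Comments (6): "for some cofinal subset `J ⊆ I`"; the identifications descend by extending
  compatible systems along `trans`, which is where functoriality is used).
* `VerticialLevelData.conj1_of_cofinal_subsingleton` — case (a) of Comments (6) packaged: if on a
  cofinal set of levels the compact `C` fixes at most one vertex, `C` lies in a verticial subgroup
  (abc-iut-L3-t6's `compactInVerticial_conj1_caseA` on the restricted data).
* `ProfiniteSemiGraph.FiniteLevelData` — the extension by the FINITE levels `𝔾_j`, the universal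
  graph-coverings `tree j ⟶ level j` and the branch-level identification (I4′) (rulings r59, ν2): the
  binders of abc-iut-L3-t11's `SemiGraph.hstar_of_noFixedBranchPairSystem`, through which total
  estrangement yields the condition (∗_j) of Comments (6)(b) consumed by the second part and by case
  (b) of the first part (sequel `TemperedCompactInVerticialHstar.lean`; the second part's earlier
  assembly `compactInVerticial_conj2_of_levelData` over "at most two fixed vertices" is a true lemma
  outside this route).

Nothing here takes a side on [IUTchIII] Cor. 3.12; statements discharged are [SemiAnbd]'s own.
-/

namespace Literature.AnabelianGeometry.SemiGraphs

namespace ProfiniteSemiGraph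

open CategoryTheory Topology

universe v u

variable {𝒢 : ProfiniteSemiGraph.{u}}

/-- **The level data of a chart** ([SemiAnbd] proof of Thm. 3.7 (iii), p. 41, with Comments (6)):
for a tempered fundamental group `c.G` of `𝒢`, a directed system of TREES `tree j` ("`𝒢_{∞,j}`, the
universal graph-covering of the underlying semi-graph of `𝒢_j`") over `𝔾 = 𝒢.graph`, acted on by
`c.G` over `𝔾` through homomorphisms with open kernels ("this action factors through a finite
quotient"), with functorial equivariant transition morphisms ("for `i ≥ j` we have natural maps
`V_i → V_j`, `E_i → E_j`"), and the three identifications of verticial / edge-like subgroups with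
stabilisers of compatible systems ("the unique elements of the `V_j` … form a compatible system of
vertices fixed by `H`. Thus … `H` is contained in some verticial subgroup"; "a compatible system of
closed edges fixed by `H` … `H` is contained in some edge-like subgroup").  The binders are those of
`compactInVerticial_conj1_caseA` and `compactInVerticial_conj2_of_levelData`.
[cite: MochizukiSemiAnbd2006, Thm 3.7(iii) p.41] -/
structure VerticialLevelData (𝒢 : ProfiniteSemiGraph.{u}) (c : TemperedPiChart 𝒢) :
    Type (max (u + 1) (v + 1)) where
  /-- the index set of levels (a cofinal system of finite étale Galois coverings `𝒢_j → 𝒢`) -/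
  J : Type v
  [preorder : Preorder J]
  [isDirected : IsDirectedOrder J]
  [nonempty : Nonempty J]
  /-- the trees `𝒢_{∞,j}` -/
  tree : J → SemiGraph.{u}
  /-- each `𝒢_{∞,j}` is a tree -/
  isTree : ∀ j, (tree j).IsTree
  /-- each `𝒢_{∞,j}` has a vertex -/
  vertex : ∀ j, (tree j).Vertex
  /-- the structure morphisms `𝒢_{∞,j} → 𝔾` -/
  proj : ∀ j, tree j ⟶ 𝒢.graph
  /-- the actions `π₁^temp(𝒢) → Aut 𝒢_{∞,j}` -/
  act : ∀ j, c.G →* Aut (tree j)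
  /-- "this action factors through a finite quotient": open kernels -/
  isOpen_ker : ∀ j, IsOpen ((act j).ker : Set c.G)
  /-- "the action of `H` is over `𝒢`" -/
  act_over : ∀ (j : J) (g : c.G), (act j g).hom ≫ proj j = proj j
  /-- the transition morphisms `𝒢_{∞,j} → 𝒢_{∞,i}`, `i ≤ j` -/
  trans : ∀ ⦃i j : J⦄, i ≤ j → (tree j ⟶ tree i)
  /-- functoriality: identities -/
  trans_id : ∀ j, trans (le_refl j) = 𝟙 (tree j)
  /-- functoriality: composition -/
  trans_comp : ∀ ⦃i j k : J⦄ (hij : i ≤ j) (hjk : j ≤ k), trans hjk ≫ trans hij = trans (hij.trans hjk)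
  /-- the transition morphisms are over `𝔾` -/
  trans_over : ∀ ⦃i j : J⦄ (h : i ≤ j), trans h ≫ proj i = proj j
  /-- the transition morphisms are equivariant -/
  trans_act : ∀ ⦃i j : J⦄ (h : i ≤ j) (g : c.G), (act j g).hom ≫ trans h = trans h ≫ (act i g).hom
  /-- (I1) every verticial subgroup fixes a compatible system of tree vertices -/
  fix : ∀ (v : 𝒢.graph.Vertex) (H : Subgroup c.G), H ∈ verticialSubgroups c v →
    ∃ x : ∀ j, (tree j).Vertex, (∀ ⦃i j : J⦄ (h : i ≤ j), (trans h).vertexMap (x j) = x i) ∧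
      ∀ g ∈ H, ∀ j, (act j g).hom.vertexMap (x j) = x j
  /-- (I2) the pointwise stabiliser of a compatible system of tree vertices lies in a verticial
  subgroup -/
  stab : ∀ x : ∀ j, (tree j).Vertex, (∀ ⦃i j : J⦄ (h : i ≤ j), (trans h).vertexMap (x j) = x i) →
    ∃ (v : 𝒢.graph.Vertex) (H : Subgroup c.G), H ∈ verticialSubgroups c v ∧
      ∀ g : c.G, (∀ j, (act j g).hom.vertexMap (x j) = x j) → g ∈ H
  /-- (I3) the stabiliser of an eventual compatible system of edges (with their branches) lies in an
  edge-like subgroup of the common image edge -/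
  edge : ∀ (j₁ : J) (ε : ∀ j : {j : J // j₁ ≤ j}, (tree j.1).Edge),
    (∀ ⦃i j : {j : J // j₁ ≤ j}⦄ (h : i.1 ≤ j.1), (trans h).edgeMap (ε j) = ε i) →
    ∃ (e : 𝒢.graph.Edge) (L : Subgroup c.G), L ∈ edgeLikeSubgroups c e ∧
      (∀ j, (proj j.1).edgeMap (ε j) = e) ∧
      ∀ g : c.G, (∀ j, (act j.1 g).hom.edgeMap (ε j) = ε j ∧
        ∀ b : (tree j.1).Branch, (tree j.1).edgeOf b = ε j → (act j.1 g).hom.branchMap b = b) → g ∈ L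

namespace VerticialLevelData

attribute [instance] VerticialLevelData.preorder VerticialLevelData.isDirected
  VerticialLevelData.nonempty

variable {c : TemperedPiChart 𝒢} (D : VerticialLevelData.{v} 𝒢 c)

/-! ### Pointwise forms of functoriality and equivariance -/

/-- Transition maps compose on vertices. [cite: MochizukiSemiAnbd2006, Thm 3.7(iii) p.41] -/
theorem trans_vertexMap_comp ⦃i j k : D.J⦄ (hij : i ≤ j) (hjk : j ≤ k) (x : (D.tree k).Vertex) :
    (D.trans hij).vertexMap ((D.trans hjk).vertexMap x) = (D.trans (hij.trans hjk)).vertexMap x := by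
  rw [← D.trans_comp hij hjk, SemiGraph.comp_vertexMap, Function.comp_apply]

/-- Transition maps compose on edges. [cite: MochizukiSemiAnbd2006, Thm 3.7(iii) p.41] -/
theorem trans_edgeMap_comp ⦃i j k : D.J⦄ (hij : i ≤ j) (hjk : j ≤ k) (e : (D.tree k).Edge) :
    (D.trans hij).edgeMap ((D.trans hjk).edgeMap e) = (D.trans (hij.trans hjk)).edgeMap e := by
  rw [← D.trans_comp hij hjk, SemiGraph.comp_edgeMap, Function.comp_apply]

/-- `trans (le_refl j)` is the identity on vertices. [cite: MochizukiSemiAnbd2006, Thm 3.7(iii) p.41] -/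
theorem trans_vertexMap_refl (j : D.J) (x : (D.tree j).Vertex) :
    (D.trans (le_refl j)).vertexMap x = x := by
  rw [D.trans_id]; rfl

/-- `trans (le_refl j)` is the identity on edges. [cite: MochizukiSemiAnbd2006, Thm 3.7(iii) p.41] -/
theorem trans_edgeMap_refl (j : D.J) (e : (D.tree j).Edge) :
    (D.trans (le_refl j)).edgeMap e = e := by
  rw [D.trans_id]; rfl

/-- Equivariance of the transition maps on vertices (the shape `hequiv` of
`compactInVerticial_conj1_caseA`). [cite: MochizukiSemiAnbd2006, Thm 3.7(iii) p.41] -/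
theorem trans_act_vertexMap ⦃i j : D.J⦄ (h : i ≤ j) (g : c.G) (x : (D.tree j).Vertex) :
    (D.trans h).vertexMap ((D.act j g).hom.vertexMap x) =
      (D.act i g).hom.vertexMap ((D.trans h).vertexMap x) := by
  have e := congrArg (fun φ => SemiGraph.Hom.vertexMap φ x) (D.trans_act h g)
  simpa only [SemiGraph.comp_vertexMap, Function.comp_apply] using e

/-- Equivariance of the transition maps on edges. [cite: MochizukiSemiAnbd2006, Thm 3.7(iii) p.41] -/
theorem trans_act_edgeMap ⦃i j : D.J⦄ (h : i ≤ j) (g : c.G) (e : (D.tree j).Edge) :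
    (D.trans h).edgeMap ((D.act j g).hom.edgeMap e) =
      (D.act i g).hom.edgeMap ((D.trans h).edgeMap e) := by
  have he := congrArg (fun φ => SemiGraph.Hom.edgeMap φ e) (D.trans_act h g)
  simpa only [SemiGraph.comp_edgeMap, Function.comp_apply] using he

/-- Over `𝔾`, an element fixing an edge fixes its branches (no branch switching).
[cite: MochizukiSemiAnbd2006, Thm 3.7(iii) p.41] -/
theorem branchMap_eq_of_edgeMap_eq (j : D.J) (g : c.G) (b : (D.tree j).Branch)
    (he : (D.act j g).hom.edgeMap ((D.tree j).edgeOf b) = (D.tree j).edgeOf b) :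
    (D.act j g).hom.branchMap b = b :=
  SemiGraph.branchMap_eq_of_over_aut (D.proj j) (D.act j g) (D.act_over j g) b he

/-! ### Restriction to a cofinal set of levels -/

section Restrict

variable (S : Set D.J) (hS : ∀ j : D.J, ∃ s ∈ S, j ≤ s)

include hS in
/-- A cofinal subset of a directed preorder is directed. [folklore] -/
private theorem isDirectedOrder_of_cofinal : IsDirectedOrder S := by
  refine ⟨fun a b => ?_⟩
  obtain ⟨k, hak, hbk⟩ := exists_ge_ge a.1 b.1
  obtain ⟨s, hs, hks⟩ := hS k
  exact ⟨⟨s, hs⟩, hak.trans hks, hbk.trans hks⟩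

include hS in
/-- A cofinal subset of a nonempty preorder is nonempty. [folklore] -/
private theorem nonempty_of_cofinal : Nonempty S := by
  obtain ⟨j⟩ := D.nonempty
  obtain ⟨s, hs, -⟩ := hS j
  exact ⟨⟨s, hs⟩⟩

/-- A choice of a level of `S` above each level. [folklore] -/
noncomputable def above (j : D.J) : S :=
  ⟨(hS j).choose, (hS j).choose_spec.1⟩

/-- The chosen level of `S` lies above. [folklore] -/
private theorem le_above (j : D.J) : j ≤ (D.above S hS j).1 := (hS j).choose_spec.2

/-- Extension of a vertex system over the cofinal `S` to all levels, along `trans`. [folklore] -/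
noncomputable def extendVertex (x : ∀ s : S, (D.tree s.1).Vertex) (j : D.J) : (D.tree j).Vertex :=
  (D.trans (D.le_above S hS j)).vertexMap (x (D.above S hS j))

/-- The extension of a compatible system agrees with it on `S`. (Comments (6) "for some cofinal
subset `J ⊆ I`": systems over a cofinal set of levels extend.) [cite: MochizukiSemiAnbd2006, Thm 3.7(iii) p.41] -/
theorem extendVertex_apply_of_mem (x : ∀ s : S, (D.tree s.1).Vertex)
    (hx : ∀ ⦃i j : S⦄ (h : i.1 ≤ j.1), (D.trans h).vertexMap (x j) = x i) (s : S) :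
    D.extendVertex S hS x s.1 = x s :=
  hx (i := s) (j := D.above S hS s.1) (D.le_above S hS s.1)

/-- The extension of a compatible system over a cofinal `S` is compatible. (Comments (6) "for some cofinal
subset `J ⊆ I`": systems over a cofinal set of levels extend.) [cite: MochizukiSemiAnbd2006, Thm 3.7(iii) p.41] -/
theorem extendVertex_compat (x : ∀ s : S, (D.tree s.1).Vertex)
    (hx : ∀ ⦃i j : S⦄ (h : i.1 ≤ j.1), (D.trans h).vertexMap (x j) = x i) ⦃i j : D.J⦄ (h : i ≤ j) :
    (D.trans h).vertexMap (D.extendVertex S hS x j) = D.extendVertex S hS x i := by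
  haveI := D.isDirectedOrder_of_cofinal S hS
  obtain ⟨t, hit, hjt⟩ := exists_ge_ge (D.above S hS i) (D.above S hS j)
  unfold extendVertex
  rw [← hx (show (D.above S hS j).1 ≤ t.1 from hjt), ← hx (show (D.above S hS i).1 ≤ t.1 from hit),
    D.trans_vertexMap_comp, D.trans_vertexMap_comp, D.trans_vertexMap_comp]

/-- An element fixing a compatible system on `S` fixes its extension. (Comments (6) "for some cofinal
subset `J ⊆ I`": systems over a cofinal set of levels extend.) [cite: MochizukiSemiAnbd2006, Thm 3.7(iii) p.41] -/
theorem act_extendVertex (x : ∀ s : S, (D.tree s.1).Vertex) (g : c.G)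
    (hg : ∀ s : S, (D.act s.1 g).hom.vertexMap (x s) = x s) (j : D.J) :
    (D.act j g).hom.vertexMap (D.extendVertex S hS x j) = D.extendVertex S hS x j := by
  unfold extendVertex
  rw [← D.trans_act_vertexMap, hg]

/-- Extension of an edge system over the cofinal `S`, from a level `j₁ ∈ S` on. [folklore] -/
noncomputable def extendEdge {j₁ : D.J} (hj₁ : j₁ ∈ S)
    (ε : ∀ s : {s : S // (⟨j₁, hj₁⟩ : S) ≤ s}, (D.tree s.1.1).Edge) (j : {j : D.J // j₁ ≤ j}) :
    (D.tree j.1).Edge :=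
  (D.trans (D.le_above S hS j.1)).edgeMap
    (ε ⟨D.above S hS j.1, show j₁ ≤ (D.above S hS j.1).1 from j.2.trans (D.le_above S hS j.1)⟩)

/-- The extension of a compatible edge system agrees with it on `S`. (Comments (6) "for some cofinal
subset `J ⊆ I`": systems over a cofinal set of levels extend.) [cite: MochizukiSemiAnbd2006, Thm 3.7(iii) p.41] -/
theorem extendEdge_apply_of_mem {j₁ : D.J} (hj₁ : j₁ ∈ S)
    (ε : ∀ s : {s : S // (⟨j₁, hj₁⟩ : S) ≤ s}, (D.tree s.1.1).Edge)
    (hε : ∀ ⦃i j : {s : S // (⟨j₁, hj₁⟩ : S) ≤ s}⦄ (h : i.1.1 ≤ j.1.1),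
      (D.trans h).edgeMap (ε j) = ε i)
    (s : {s : S // (⟨j₁, hj₁⟩ : S) ≤ s}) :
    D.extendEdge S hS hj₁ ε ⟨s.1.1, s.2⟩ = ε s :=
  hε (i := s) (j := ⟨D.above S hS s.1.1, _⟩) (D.le_above S hS s.1.1)

/-- The extension of a compatible edge system over a cofinal `S` is compatible. (Comments (6) "for some cofinal
subset `J ⊆ I`": systems over a cofinal set of levels extend.) [cite: MochizukiSemiAnbd2006, Thm 3.7(iii) p.41] -/
theorem extendEdge_compat {j₁ : D.J} (hj₁ : j₁ ∈ S)
    (ε : ∀ s : {s : S // (⟨j₁, hj₁⟩ : S) ≤ s}, (D.tree s.1.1).Edge)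
    (hε : ∀ ⦃i j : {s : S // (⟨j₁, hj₁⟩ : S) ≤ s}⦄ (h : i.1.1 ≤ j.1.1),
      (D.trans h).edgeMap (ε j) = ε i)
    ⦃i j : {j : D.J // j₁ ≤ j}⦄ (h : i.1 ≤ j.1) :
    (D.trans h).edgeMap (D.extendEdge S hS hj₁ ε j) = D.extendEdge S hS hj₁ ε i := by
  haveI := D.isDirectedOrder_of_cofinal S hS
  obtain ⟨t, hit, hjt⟩ := exists_ge_ge (D.above S hS i.1) (D.above S hS j.1)
  have ht₁ : (⟨j₁, hj₁⟩ : S) ≤ t := (j.2.trans (D.le_above S hS j.1)).trans hjt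
  unfold extendEdge
  rw [← hε (i := ⟨D.above S hS j.1, _⟩) (j := ⟨t, ht₁⟩) (show (D.above S hS j.1).1 ≤ t.1 from hjt),
    ← hε (i := ⟨D.above S hS i.1, _⟩) (j := ⟨t, ht₁⟩) (show (D.above S hS i.1).1 ≤ t.1 from hit),
    D.trans_edgeMap_comp, D.trans_edgeMap_comp, D.trans_edgeMap_comp]

/-- An element fixing a compatible edge system on `S` fixes its extension. (Comments (6) "for some cofinal
subset `J ⊆ I`": systems over a cofinal set of levels extend.) [cite: MochizukiSemiAnbd2006, Thm 3.7(iii) p.41] -/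
theorem act_extendEdge {j₁ : D.J} (hj₁ : j₁ ∈ S)
    (ε : ∀ s : {s : S // (⟨j₁, hj₁⟩ : S) ≤ s}, (D.tree s.1.1).Edge) (g : c.G)
    (hg : ∀ s, (D.act s.1.1 g).hom.edgeMap (ε s) = ε s) (j : {j : D.J // j₁ ≤ j}) :
    (D.act j.1 g).hom.edgeMap (D.extendEdge S hS hj₁ ε j) = D.extendEdge S hS hj₁ ε j := by
  have h2 := hg ⟨D.above S hS j.1, j.2.trans (D.le_above S hS j.1)⟩
  unfold extendEdge
  rw [← D.trans_act_edgeMap, h2]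

/-- **Level data restrict to a cofinal set of levels** (Comments (6): "for some cofinal subset
`J ⊆ I`"): the trees, actions and transition maps restrict verbatim; (I1) restricts; (I2) and (I3)
descend by extending compatible systems from the cofinal subset to all levels along the functorial
transition maps. [cite: MochizukiSemiAnbd2006, Thm 3.7(iii) p.41] -/
noncomputable def restrict : VerticialLevelData.{v} 𝒢 c where
  J := S
  preorder := inferInstance
  isDirected := D.isDirectedOrder_of_cofinal S hS
  nonempty := D.nonempty_of_cofinal S hS
  tree s := D.tree s.1
  isTree s := D.isTree s.1
  vertex s := D.vertex s.1
  proj s := D.proj s.1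
  act s := D.act s.1
  isOpen_ker s := D.isOpen_ker s.1
  act_over s g := D.act_over s.1 g
  trans _ _ h := D.trans (show _ ≤ _ from h)
  trans_id s := D.trans_id s.1
  trans_comp _ _ _ hij hjk := D.trans_comp (show _ ≤ _ from hij) (show _ ≤ _ from hjk)
  trans_over _ _ h := D.trans_over (show _ ≤ _ from h)
  trans_act _ _ h g := D.trans_act (show _ ≤ _ from h) g
  fix v H hH := by
    obtain ⟨x, hxc, hxf⟩ := D.fix v H hH
    exact ⟨fun s => x s.1, fun i j h => hxc (show i.1 ≤ j.1 from h), fun g hg s => hxf g hg s.1⟩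
  stab x hx := by
    obtain ⟨v, H, hH, hstab⟩ := D.stab (D.extendVertex S hS x) (D.extendVertex_compat S hS x hx)
    refine ⟨v, H, hH, fun g hg => hstab g fun j => D.act_extendVertex S hS x g hg j⟩
  edge j₁ ε hε := by
    obtain ⟨e, L, hL, hpe, hLstab⟩ :=
      D.edge j₁.1 (D.extendEdge S hS j₁.2 ε) (D.extendEdge_compat S hS j₁.2 ε hε)
    refine ⟨e, L, hL, fun s => ?_, fun g hg => hLstab g fun j => ?_⟩
    · rw [← hpe ⟨s.1.1, s.2⟩, D.extendEdge_apply_of_mem S hS j₁.2 ε hε s]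
    · have hfix : (D.act j.1 g).hom.edgeMap (D.extendEdge S hS j₁.2 ε j) = D.extendEdge S hS j₁.2 ε j :=
        D.act_extendEdge S hS j₁.2 ε g (fun s => (hg s).1) j
      exact ⟨hfix, fun b hb => D.branchMap_eq_of_edgeMap_eq j.1 g b (by rw [hb]; exact hfix)⟩

end Restrict

/-! ### Theorem 3.7 (iii) over the level data -/

/-- **Thm. 3.7 (iii), first part, case (a) of Comments (6)**, over the level data: if on a COFINAL
set `S` of levels the compact subgroup `C` fixes at most one vertex of the tree, then `C` lies in a
verticial subgroup (abc-iut-L3-t6's `compactInVerticial_conj1_caseA` applied to the restricted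
data). [cite: MochizukiSemiAnbd2006, Thm 3.7(iii) p.41] -/
theorem conj1_of_cofinal_subsingleton (C : Subgroup c.G) (hC : IsCompact (C : Set c.G))
    (S : Set D.J) (hS : ∀ j : D.J, ∃ s ∈ S, j ≤ s)
    (hone : ∀ s ∈ S, {x : (D.tree s).Vertex | ∀ g : C, (D.act s g).hom.vertexMap x = x}.Subsingleton) :
    ∃ (v : 𝒢.graph.Vertex) (H : Subgroup c.G), H ∈ verticialSubgroups c v ∧ C ≤ H :=
  let D' := D.restrict S hS
  compactInVerticial_conj1_caseA c D'.tree D'.isTree D'.vertex D'.proj D'.act D'.isOpen_ker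
    D'.act_over D'.trans D'.trans_act_vertexMap D'.stab C hC fun s => hone s.1 s.2

/-- **Thm. 3.7 (iii), first part**, over the level data and modulo case (b) of Comments (6) as a
named input: the formal step (c) (`compactInVerticial_conj1_of_cases`) with case (a) discharged by
`conj1_of_cofinal_subsingleton`. [cite: MochizukiSemiAnbd2006, Thm 3.7(iii) p.41] -/
theorem conj1_of_caseB (C : Subgroup c.G) (hC : IsCompact (C : Set c.G))
    (caseB : (∀ j : D.J, ∃ s, ¬ {x : (D.tree s).Vertex |
        ∀ g : C, (D.act s g).hom.vertexMap x = x}.Subsingleton ∧ j ≤ s) →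
      ∃ (v : 𝒢.graph.Vertex) (H : Subgroup c.G), H ∈ verticialSubgroups c v ∧ C ≤ H) :
    ∃ (v : 𝒢.graph.Vertex) (H : Subgroup c.G), H ∈ verticialSubgroups c v ∧ C ≤ H :=
  compactInVerticial_conj1_of_cases c
    (fun j : D.J => {x : (D.tree j).Vertex | ∀ g : C, (D.act j g).hom.vertexMap x = x}.Subsingleton) C
    (fun hA => D.conj1_of_cofinal_subsingleton C hC {s | {x : (D.tree s).Vertex |
        ∀ g : C, (D.act s g).hom.vertexMap x = x}.Subsingleton}
      (fun j => let ⟨s, hs, hjs⟩ := hA j; ⟨s, hs, hjs⟩) fun _ hs => hs)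
    caseB

end VerticialLevelData

/-! ### The finite levels (cell ruling θ2 / r59) -/

/-- **Level data with the finite levels** ([SemiAnbd] proof of Thm. 3.7 (iii), p. 41, with Comments (6)(b):
"since `𝔾_j` is untangled … the respective images `f_{j,i}`, `f'_{j,i}` of `e_{j,i}`, `e'_{j,i}` in `𝔾_j`
also form a subjoint … the subjoints `(f_i, f'_i)`, where `i ∈ J*`, converge, in the profinite topology, to
some profinite subjoint … in light of our assumption that `𝒢` is totally estranged"): the tree-level data
EXTENDED by the finite graphs `level j` (the underlying semi-graphs `𝔾_j` of the finite étale Galois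
coverings `𝒢_j`), the universal graph-coverings `quot j : tree j ⟶ level j` (immersions), the induced
actions `levelAct j` and transition morphisms `levelTrans` with their commuting squares — exactly the
binders of `SemiGraph.hstar_of_noFixedBranchPairSystem` (seat abc-iut-L3-t11) — and the branch-level
identification (I4′) `stabBranchPair'` (Remark 2.2.1 at branch level, cell ruling ν2: the pointwise
stabiliser of a compatible system `(w_i; β_i ≠ β'_i)` of a vertex with two distinct abutting branches of
the finite levels lies, after an injection `ιQ` of `π₁^temp(𝒢)` into an overgroup `Q` (produced as a
compact completion), in `ψ(x Π_b x⁻¹) ∩ ψ(x' Π_{b'} x'⁻¹)` for an injective `ψ : Π_v → Q` and two distinct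
branch-cosets at `v`; text by abc-iut-L3-t11, consumer `noFixedBranchPairSystem_of_isTotallyEstranged'`),
which total estrangement turns into "no nontrivial subgroup fixes such a system", whence (∗_j). PRODUCER CONTRACT (rung 1): the
Galois tower of `B^temp(𝒢)` with its universal graph-coverings. [cite: MochizukiSemiAnbd2006, Thm 3.7(iii) p.41] -/
structure FiniteLevelData (𝒢 : ProfiniteSemiGraph.{u}) (c : TemperedPiChart 𝒢)
    extends VerticialLevelData.{v} 𝒢 c where
  /-- the finite semi-graphs `𝔾_j` underlying the finite étale Galois coverings `𝒢_j → 𝒢` -/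
  level : J → SemiGraph.{u}
  [finiteVertex : ∀ j, Finite (level j).Vertex]
  [finiteBranch : ∀ j, Finite (level j).Branch]
  /-- the universal graph-coverings `𝒢_{∞,j} → 𝔾_j` -/
  quot : ∀ j, tree j ⟶ level j
  /-- graph-coverings are immersions -/
  quot_isImmersion : ∀ j, SemiGraph.IsImmersion (quot j)
  /-- the induced actions on the finite levels -/
  levelAct : ∀ j, c.G →* Aut (level j)
  /-- `quot` is equivariant -/
  act_quot : ∀ (j : J) (g : c.G), (act j g).hom ≫ quot j = quot j ≫ (levelAct j g).hom
  /-- the transition morphisms `𝔾_j → 𝔾_i`, `i ≤ j` -/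
  levelTrans : ∀ ⦃i j : J⦄, i ≤ j → (level j ⟶ level i)
  /-- functoriality: identities -/
  levelTrans_id : ∀ j, levelTrans (le_refl j) = 𝟙 (level j)
  /-- functoriality: composition -/
  levelTrans_comp : ∀ ⦃i j k : J⦄ (hij : i ≤ j) (hjk : j ≤ k),
    levelTrans hjk ≫ levelTrans hij = levelTrans (hij.trans hjk)
  /-- the finite-level transition morphisms are equivariant -/
  levelTrans_act : ∀ ⦃i j : J⦄ (h : i ≤ j) (g : c.G),
    (levelAct j g).hom ≫ levelTrans h = levelTrans h ≫ (levelAct i g).hom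
  /-- the transition morphisms of the trees cover those of the finite levels -/
  trans_quot : ∀ ⦃i j : J⦄ (h : i ≤ j), trans h ≫ quot i = quot j ≫ levelTrans h
  /-- (I4′) Remark 2.2.1 at branch level (ruling ν2): after an injection `ιQ : π₁^temp(𝒢) → Q`, the
  stabiliser of a compatible finite-level branch-pair system lies in two distinct branch-conjugates -/
  stabBranchPair' : ∀ (j₀ : J) (w : ∀ i : {i : J // j₀ ≤ i}, (level i.1).Vertex)
    (β β' : ∀ i : {i : J // j₀ ≤ i}, (level i.1).Branch),
    (∀ i, β i ≠ β' i ∧ (level i.1).abuts (β i) = some (w i) ∧ (level i.1).abuts (β' i) = some (w i)) →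
    (∀ ⦃i i' : {i : J // j₀ ≤ i}⦄ (h : i.1 ≤ i'.1), (levelTrans h).vertexMap (w i') = w i ∧
      (levelTrans h).branchMap (β i') = β i ∧ (levelTrans h).branchMap (β' i') = β' i) →
    ∃ (Q : Type u) (_ : Group Q) (ιQ : c.G →* Q) (v : 𝒢.graph.Vertex) (b b' : 𝒢.graph.Branch)
      (hb : 𝒢.graph.abuts b = some v) (hb' : 𝒢.graph.abuts b' = some v) (ψ : 𝒢.Gv v →* Q) (x x' : 𝒢.Gv v),
      Function.Injective ιQ ∧ Function.Injective ψ ∧ (b' ≠ b ∨ x⁻¹ * x' ∉ 𝒢.branchSubgroup b v hb) ∧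
      ∀ g : c.G, (∀ i, (levelAct i.1 g).hom.vertexMap (w i) = w i ∧
        (levelAct i.1 g).hom.branchMap (β i) = β i ∧ (levelAct i.1 g).hom.branchMap (β' i) = β' i) →
        ιQ g ∈ ((𝒢.branchSubgroup b v hb).map (MulAut.conj x).toMonoidHom).map ψ ⊓
          ((𝒢.branchSubgroup b' v hb').map (MulAut.conj x').toMonoidHom).map ψ

attribute [instance] FiniteLevelData.finiteVertex FiniteLevelData.finiteBranch

end ProfiniteSemiGraph

end Literature.AnabelianGeometry.SemiGraphs
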